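import Summits.Ventures.LatticeQCDFlow.Scaling.BooleanStarLumpedBracket

/-!
HONEST FRAMING: exact (Metropolis-corrected) sampling algorithms for lattice gauge theory; figures
of merit are autocorrelation/cost numbers at stated couplings and volumes; no continuum-physics
claim.

# BooleanStarThreeStateReduction — OPEN-MATH ITEM 1 (ii) FOR THE HOMOGENEOUS BOOLEAN STAR (ALL `K`) REDUCED TO THREE FUNCTIONS `U, V, W` OF `(D, N)`:
# IF THEY SOLVE THE THREE ALIGNED CYCLE EQUATIONS, ARE MONOTONE (`V(D−1,N) ≤ W(D,N)`) AND CONTRACT AT THE REDRAW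
# (`μ_0(b)U + μ_0(b̄)V ≤ (1−ρ)Ψ`), THEN `t_mix(ε) ≤ ⌈(4/((1−t)w_0ρ))·log((eΨ_max+1)/ε)⌉` (lean-2 GEN-32, ours)

Venture-side (OURS).  Cell `lqcd-flow` (pub-lqcd), unit `pub-lqcd-lean-2-g32`, 2026-08-29.  Chapter S, file 5: the typed form of the reduction found numerically in
`lean-2/MEMO-gen32-certificate-largeK.md` §10.  Setting of `BooleanStarLumpedBracket` (contents `Bool`, identity maps, homogeneous cold law `μ_1`, uniform entry list, idle cold
levels, exact hot redraws), liked content `b` (`μ_0(b)μ_1(b̄) ≤ μ_0(b̄)μ_1(b)`), `rr = μ_0(b)μ_1(b̄)/(μ_0(b̄)μ_1(b))` (the acceptance of the disliked content into a level holding the liked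
one; the other three acceptances are `1`).  With `D = #{cold defects}` (both orientations), `N = #{agreeing levels holding b̄}`, `G = #{agreeing levels holding b}`, the candidate
certificate is TYPE-LUMPED with `F = U(D,N)` at hubs `(b,b)`, `V(D,N)` at hubs `(b̄,b̄)`, `W(D,N)` at mixed hubs, `Ψ = Ψa(D,N)`.  THE REDUCTION: if `(U,V,W)` satisfy the three
ALIGNED cycle equations — `(t+h)U = hΨa + (t/K)[G·U + N·V(D,N−1) + D·W(D−1,N)]`, `(t+h)V = hΨa + (t/K)[G(rr·U(D,N+1) + (1−rr)V) + N·V + D(rr·W(D−1,N+1) + (1−rr)V)]`,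
`(t+h)W = hΨa + (t/K)[G(rr·U(D+1,N) + (1−rr)W) + N·V(D+1,N−1) + D·W]` (`h = (1−t)w_0`; in the aligned sector these say that `(U,V,W)` is the exact cycle value of the
three-state chain `{(bb,s,N),(b̄b̄,s,N−1),(bb̄,s−1,N)}`) — and the monotonicity `V(D−1,N) ≤ W(D,N)`, then EVERY lumped bracket inequality of `BooleanStarLumpedBracket` holds:
with equality at agreeing hubs (heals of either orientation lead to the same `W(D−1,N)`), and at mixed hubs with the slack `(t/K)·#{defects of the other orientation}·(1−rr)·(W(D,N) −
V(D−1,N)) ≥ 0` coming from crossed heals.  So the certificate for all `K` is: the three equations, the monotonicity, non-negativity, `1 ≤ Ψa ≤ Ψ_max` on `D ≥ 1`, and ONE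
inequality — the redraw contraction `μ_0(b)·U(D,N) + μ_0(b̄)·V(D,N) ≤ (1−ρ)·Ψa(D,N)`.  Hypothesis-equations throughout (all indexed by pairs); no definitions.

## What is proved

* §1 `boolStar_acc_self`, `boolStar_acc_liked`, `boolStar_acc_disliked` (the four acceptances: `1, 1, 1, rr`).
* §2 `boolStar_Dc_shift`, `boolStar_Nc_shift` (`D` and `N` of a shifted count function), **`boolStar_lumped_bracket_of_threeState`** (the title's bracket statement, eight hub cases
  by `linear_combination`).
* §3 **`boolStar_mixingTime_le_of_threeState`** — the three equations + monotonicity + `U,V,W ≥ 0` + `0 ≤ Ψa ≤ Ψ_max`, `Ψa ≥ 1` where a cold level differs + the redraw contraction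
  (`0 < ρ ≤ 1`) ⇒ `t_mix(ε) ≤ ⌈(4/((1−t)w_0·ρ))·log((e·Ψ_max+1)/ε)⌉₊`.

Reading (no numerics implied): the memo's toy computations exhibit `(U,V,W)` = the exact three-state values for `Ψa(D,N) = D + hub_W(N−N*) + hub_W(N+D−N*)` with the
monotonicity holding by a margin `≥ 1` and the redraw contraction with `ρ ≥ 0.44·(p/K)·min{1,t/h}` for `K ≤ 256`; proving those two inequalities for the explicit rational
functions is what remains of item 1 (ii) for the homogeneous Boolean star.  NOT CLAIMED: that; anything measured.  Literature grade (cell rule): OWN, elementary; nothing cited as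
a fact; no new bib keys.
-/

noncomputable section

open Finset Function Matrix
open Literature.Probability.MarkovChains

namespace Summit.Ventures.LatticeQCDFlow.Scaling

variable {K : ℕ} {μ : Fin (K + 1) → Bool → ℝ}

/-! ## §1 The four acceptances of the Boolean star -/

/-- Equal contents: acceptance `1` (the swap is the identity). [ours] -/
theorem boolStar_acc_self (hμ : ∀ k x, 0 < μ k x) {acc : Bool → Bool → ℝ} (hacc : ∀ u v, acc u v = min 1 (μ 0 v * μ 1 u / (μ 0 u * μ 1 v))) (u : Bool) :
    acc u u = 1 := by
  rw [hacc, mul_comm (μ 0 u), div_self (mul_pos (hμ 1 u) (hμ 0 u)).ne', min_self]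

/-- The liked content enters a level holding the disliked one with certainty: `acc(b, b̄) = 1` when `μ_1(b)μ_0(b̄) ≥ μ_0(b)μ_1(b̄)`. [ours] -/
theorem boolStar_acc_liked (hμ : ∀ k x, 0 < μ k x) {acc : Bool → Bool → ℝ} (hacc : ∀ u v, acc u v = min 1 (μ 0 v * μ 1 u / (μ 0 u * μ 1 v)))
    {b : Bool} (hb : μ 0 b * μ 1 (!b) ≤ μ 0 (!b) * μ 1 b) : acc b (!b) = 1 := by
  rw [hacc, min_eq_left]
  rw [le_div_iff₀ (mul_pos (hμ 0 b) (hμ 1 (!b))), one_mul]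
  exact hb

/-- The disliked content enters a level holding the liked one with probability `rr = μ_0(b)μ_1(b̄)/(μ_0(b̄)μ_1(b)) ≤ 1`. [ours] -/
theorem boolStar_acc_disliked (hμ : ∀ k x, 0 < μ k x) {acc : Bool → Bool → ℝ} (hacc : ∀ u v, acc u v = min 1 (μ 0 v * μ 1 u / (μ 0 u * μ 1 v)))
    {b : Bool} (hb : μ 0 b * μ 1 (!b) ≤ μ 0 (!b) * μ 1 b) {rr : ℝ} (hrr : rr = μ 0 b * μ 1 (!b) / (μ 0 (!b) * μ 1 b)) :
    acc (!b) b = rr ∧ 0 ≤ rr ∧ rr ≤ 1 := by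
  have hpos : 0 < μ 0 (!b) * μ 1 b := mul_pos (hμ 0 _) (hμ 1 _)
  have h1 : rr ≤ 1 := by rw [hrr, div_le_one hpos]; exact hb
  refine ⟨?_, by rw [hrr]; exact div_nonneg (mul_nonneg (hμ 0 _).le (hμ 1 _).le) hpos.le, h1⟩
  rw [hacc, ← hrr, min_eq_right h1]


/-! ## §2 The reduction: three functions of `(D, N)` pass every lumped bracket inequality -/

section Reduction
variable {m : ℕ} {w : Fin (K + 1) → ℝ} {t : ℝ} (κ : Fin m → Fin K)
variable {cnt : (Fin (K + 1) → Bool) × (Fin (K + 1) → Bool) → Bool → Bool → ℝ}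

omit κ in
/-- `D` of a shifted count function. [ours] -/
theorem boolStar_Dc_shift {b : Bool} {Dc : (Bool → Bool → ℝ) → ℝ} (hD : ∀ c, Dc c = c b (!b) + c (!b) b) (c f g : Bool → Bool → ℝ) :
    Dc (fun s t' => c s t' - f s t' + g s t') = Dc c - (f b (!b) + f (!b) b) + (g b (!b) + g (!b) b) := by
  rw [hD, hD]; ring

omit κ in
/-- `N` of a shifted count function. [ours] -/
theorem boolStar_Nc_shift {b : Bool} {Nc : (Bool → Bool → ℝ) → ℝ} (hN : ∀ c, Nc c = c (!b) (!b)) (c f g : Bool → Bool → ℝ) :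
    Nc (fun s t' => c s t' - f s t' + g s t') = Nc c - f (!b) (!b) + g (!b) (!b) := by
  rw [hN, hN]

/-- **THE LUMPED BRACKET INEQUALITIES FROM THREE FUNCTIONS OF `(D, N)`.**  Homogeneous Boolean star, liked content `b` (`μ_0(b)μ_1(b̄) ≤ μ_0(b̄)μ_1(b)`),
`rr = μ_0(b)μ_1(b̄)/(μ_0(b̄)μ_1(b))`.  Let `U, V, W, Ψa` be functions of `(D, N)` = (number of cold defects, number of agreeing levels holding `b̄`) and define the type-lumped
`F = Fl(x_0,y_0,cnt)` by `U` at hubs `(b,b)`, `V` at hubs `(b̄,b̄)`, `W` at mixed hubs, and `Ψ = Ψa(D,N)`.  If at every pair the three ALIGNED cycle equations hold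
(`G = cnt(b,b)` good levels, `N = cnt(b̄,b̄)`, `D = cnt(b,b̄) + cnt(b̄,b)`, `h = (1−t)w_0`):
`(t+h)U(D,N) = hΨa(D,N) + (t/K)[G·U(D,N) + N·V(D,N−1) + D·W(D−1,N)]`,
`(t+h)V(D,N) = hΨa(D,N) + (t/K)[G·(rr·U(D,N+1) + (1−rr)V(D,N)) + N·V(D,N) + D·(rr·W(D−1,N+1) + (1−rr)V(D,N))]`,
`(t+h)W(D,N) = hΨa(D,N) + (t/K)[G·(rr·U(D+1,N) + (1−rr)W(D,N)) + N·V(D+1,N−1) + D·W(D,N)]`,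
and the MONOTONICITY `V(D−1,N) ≤ W(D,N)`, then the lumped bracket inequality of `boolStar_mixingTime_le_of_lumped_supersolution` holds at every pair — with equality at
agreeing hubs, and with slack `(t/K)·#{crossed levels of the other orientation}·(1−rr)·(W(D,N) − V(D−1,N))` at mixed hubs. [ours] -/
theorem boolStar_lumped_bracket_of_threeState (ht0 : 0 ≤ t) (hμ : ∀ k x, 0 < μ k x)
    {b : Bool} (hb : μ 0 b * μ 1 (!b) ≤ μ 0 (!b) * μ 1 b) {rr : ℝ} (hrr : rr = μ 0 b * μ 1 (!b) / (μ 0 (!b) * μ 1 b))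
    {acc : Bool → Bool → ℝ} (hacc : ∀ u v, acc u v = min 1 (μ 0 v * μ 1 u / (μ 0 u * μ 1 v)))
    (hcnt : ∀ a s t, cnt a s t = ((univ.filter fun i : Fin K => a.1 i.succ = s ∧ a.2 i.succ = t).card : ℝ))
    {Dc Nc : (Bool → Bool → ℝ) → ℝ} (hD : ∀ c, Dc c = c b (!b) + c (!b) b) (hN : ∀ c, Nc c = c (!b) (!b))
    {U V W Ψa : ℝ → ℝ → ℝ} {Fl Ψl : Bool → Bool → (Bool → Bool → ℝ) → ℝ}
    (hFl : ∀ x0 y0 c, Fl x0 y0 c = if x0 = y0 then (if x0 = b then U (Dc c) (Nc c) else V (Dc c) (Nc c)) else W (Dc c) (Nc c))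
    (hΨl : ∀ x0 y0 c, Ψl x0 y0 c = Ψa (Dc c) (Nc c))
    (eqU : ∀ a : (Fin (K + 1) → Bool) × (Fin (K + 1) → Bool),
      (t + (1 - t) * w 0) * U (Dc (cnt a)) (Nc (cnt a)) = (1 - t) * w 0 * Ψa (Dc (cnt a)) (Nc (cnt a))
        + t / K * (cnt a b b * U (Dc (cnt a)) (Nc (cnt a)) + cnt a (!b) (!b) * V (Dc (cnt a)) (Nc (cnt a) - 1)
          + Dc (cnt a) * W (Dc (cnt a) - 1) (Nc (cnt a))))
    (eqV : ∀ a : (Fin (K + 1) → Bool) × (Fin (K + 1) → Bool),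
      (t + (1 - t) * w 0) * V (Dc (cnt a)) (Nc (cnt a)) = (1 - t) * w 0 * Ψa (Dc (cnt a)) (Nc (cnt a))
        + t / K * (cnt a b b * (rr * U (Dc (cnt a)) (Nc (cnt a) + 1) + (1 - rr) * V (Dc (cnt a)) (Nc (cnt a)))
          + cnt a (!b) (!b) * V (Dc (cnt a)) (Nc (cnt a))
          + Dc (cnt a) * (rr * W (Dc (cnt a) - 1) (Nc (cnt a) + 1) + (1 - rr) * V (Dc (cnt a)) (Nc (cnt a)))))
    (eqW : ∀ a : (Fin (K + 1) → Bool) × (Fin (K + 1) → Bool),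
      (t + (1 - t) * w 0) * W (Dc (cnt a)) (Nc (cnt a)) = (1 - t) * w 0 * Ψa (Dc (cnt a)) (Nc (cnt a))
        + t / K * (cnt a b b * (rr * U (Dc (cnt a) + 1) (Nc (cnt a)) + (1 - rr) * W (Dc (cnt a)) (Nc (cnt a)))
          + cnt a (!b) (!b) * V (Dc (cnt a) + 1) (Nc (cnt a) - 1)
          + Dc (cnt a) * W (Dc (cnt a)) (Nc (cnt a))))
    (mono : ∀ a : (Fin (K + 1) → Bool) × (Fin (K + 1) → Bool), V (Dc (cnt a) - 1) (Nc (cnt a)) ≤ W (Dc (cnt a)) (Nc (cnt a)))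
    (a : (Fin (K + 1) → Bool) × (Fin (K + 1) → Bool)) :
    (1 - t) * w 0 * Ψl (a.1 0) (a.2 0) (cnt a)
        + t / K * ∑ st : Bool × Bool, cnt a st.1 st.2 *
          (min (acc (a.1 0) st.1) (acc (a.2 0) st.2)
              * Fl st.1 st.2 (fun s t' => cnt a s t' - (if st.1 = s ∧ st.2 = t' then 1 else 0) + (if a.1 0 = s ∧ a.2 0 = t' then 1 else 0))
            + (acc (a.1 0) st.1 - min (acc (a.1 0) st.1) (acc (a.2 0) st.2))
              * Fl st.1 (a.2 0) (fun s t' => cnt a s t' - (if st.1 = s ∧ st.2 = t' then 1 else 0) + (if a.1 0 = s ∧ st.2 = t' then 1 else 0))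
            + (acc (a.2 0) st.2 - min (acc (a.1 0) st.1) (acc (a.2 0) st.2))
              * Fl (a.1 0) st.2 (fun s t' => cnt a s t' - (if st.1 = s ∧ st.2 = t' then 1 else 0) + (if st.1 = s ∧ a.2 0 = t' then 1 else 0))
            + (1 - acc (a.1 0) st.1 - acc (a.2 0) st.2 + min (acc (a.1 0) st.1) (acc (a.2 0) st.2)) * Fl (a.1 0) (a.2 0) (cnt a))
      ≤ (t + (1 - t) * w 0) * Fl (a.1 0) (a.2 0) (cnt a) := by
  have hK0 : 0 ≤ t / K := div_nonneg ht0 (Nat.cast_nonneg K)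
  obtain ⟨hnb, hrr0, hrr1⟩ := boolStar_acc_disliked hμ hacc hb hrr
  have hbn := boolStar_acc_liked hμ hacc hb
  have hs := boolStar_acc_self hμ hacc
  have hmin1 : min 1 rr = rr := min_eq_right hrr1
  have hmin2 : min rr 1 = rr := min_eq_left hrr1
  have hc0 : ∀ s t', 0 ≤ cnt a s t' := fun s t' => by rw [hcnt]; exact Nat.cast_nonneg _
  have hDa : Dc (cnt a) = cnt a b (!b) + cnt a (!b) b := hD _
  have e1 := eqU a
  have e2 := eqV a
  have e3 := eqW a
  -- the slack of the crossed levels, both orientations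
  have x1 : 0 ≤ t / K * cnt a (!b) b * (1 - rr) * (W (Dc (cnt a)) (Nc (cnt a)) - V (Dc (cnt a) - 1) (Nc (cnt a))) :=
    mul_nonneg (mul_nonneg (mul_nonneg hK0 (hc0 _ _)) (by linarith)) (by linarith [mono a])
  have x2 : 0 ≤ t / K * cnt a b (!b) * (1 - rr) * (W (Dc (cnt a)) (Nc (cnt a)) - V (Dc (cnt a) - 1) (Nc (cnt a))) :=
    mul_nonneg (mul_nonneg (mul_nonneg hK0 (hc0 _ _)) (by linarith)) (by linarith [mono a])
  have hDs := boolStar_Dc_shift hD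
  have hNs := boolStar_Nc_shift hN
  clear mono eqU eqV eqW hD hN
  obtain ⟨x, y⟩ := a
  cases b <;> simp only [Bool.not_true, Bool.not_false] at hbn hnb e1 e2 e3 x1 x2 hDa hFl hDs hNs <;>
    rcases Bool.eq_false_or_eq_true (x 0) with hx0 | hx0 <;> rcases Bool.eq_false_or_eq_true (y 0) with hy0 | hy0 <;>
    simp only [Fintype.sum_prod_type, Fintype.sum_bool, hx0, hy0, hFl, hΨl, hDs, hNs, hs, hbn, hnb,
      if_true, if_false, true_and, and_true, false_and, and_false, Bool.true_eq_false, Bool.false_eq_true, min_self,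
      hmin1, hmin2, sub_self, sub_zero, add_zero, zero_add, zero_mul, one_mul, sub_add_cancel]
  -- goals in the order (x_0,y_0) = (tt,tt), (tt,ff), (ff,tt), (ff,ff); first `b = false`, then `b = true`
  · linear_combination -e2 - (rr * W (Dc (cnt (x, y)) - 1) (Nc (cnt (x, y)) + 1) + (1 - rr) * V (Dc (cnt (x, y))) (Nc (cnt (x, y)))) * (t / K) * hDa
  · linear_combination -e3 + x2 - W (Dc (cnt (x, y))) (Nc (cnt (x, y))) * (t / K) * hDa
  · linear_combination -e3 + x1 - W (Dc (cnt (x, y))) (Nc (cnt (x, y))) * (t / K) * hDa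
  · linear_combination -e1 - W (Dc (cnt (x, y)) - 1) (Nc (cnt (x, y))) * (t / K) * hDa
  · linear_combination -e1 - W (Dc (cnt (x, y)) - 1) (Nc (cnt (x, y))) * (t / K) * hDa
  · linear_combination -e3 + x1 - W (Dc (cnt (x, y))) (Nc (cnt (x, y))) * (t / K) * hDa
  · linear_combination -e3 + x2 - W (Dc (cnt (x, y))) (Nc (cnt (x, y))) * (t / K) * hDa
  · linear_combination -e2 - (rr * W (Dc (cnt (x, y)) - 1) (Nc (cnt (x, y)) + 1) + (1 - rr) * V (Dc (cnt (x, y))) (Nc (cnt (x, y)))) * (t / K) * hDa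

end Reduction

/-! ## §3 The law -/

section Law
variable {M : Fin (K + 1) → Bool → Bool → ℝ} {w : Fin (K + 1) → ℝ} {t : ℝ} {m : ℕ} (κ : Fin m → Fin K)
variable {cnt : (Fin (K + 1) → Bool) × (Fin (K + 1) → Bool) → Bool → Bool → ℝ}

/-- **OPEN-MATH ITEM 1 (ii) FOR THE HOMOGENEOUS BOOLEAN STAR, REDUCED TO THREE FUNCTIONS OF `(D, N)`.**  Persistent hub with `K` cold levels, contents `Bool`, identity maps,
homogeneous cold law `μ_1`, uniform entry list (`c` entries per level), idle cold levels, exact hot redraws at weight `w_0 > 0`, swap rate `0 ≤ t < 1`, liked content `b`,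
`rr = μ_0(b)μ_1(b̄)/(μ_0(b̄)μ_1(b))`.  If functions `U, V, W, Ψa` of `(D, N)` satisfy, at every pair: the three aligned cycle equations of `boolStar_lumped_bracket_of_threeState`,
the monotonicity `V(D−1,N) ≤ W(D,N)`, non-negativity `U, V, W ≥ 0`, `0 ≤ Ψa ≤ Ψ_max`, `Ψa ≥ 1` where a cold level differs, and the REDRAW CONTRACTION
`μ_0(b)·U(D,N) + μ_0(b̄)·V(D,N) ≤ (1−ρ)·Ψa(D,N)` (`0 < ρ ≤ 1`), then **`t_mix(ε) ≤ ⌈(4/((1−t)w_0·ρ))·log((e·Ψ_max+1)/ε)⌉₊`**. [ours] -/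
theorem boolStar_mixingTime_le_of_threeState (hm : 1 ≤ m) (ht0 : 0 ≤ t) (ht1 : t < 1) (hw0 : ∀ k, 0 ≤ w k) (hw00 : 0 < w 0)
    (hw1 : ∑ k, w k = 1) (hμ : ∀ k x, 0 < μ k x) (hμ1 : ∀ k, ∑ u, μ k u = 1) (hM0 : ∀ u v, M 0 u v = μ 0 v)
    (hidle : ∀ i : Fin K, ∀ u v, M i.succ u v = if v = u then 1 else 0) (hhom : ∀ i : Fin K, μ i.succ = μ 1)
    {c : ℕ} (hunif : ∀ i : Fin K, (univ.filter fun r : Fin m => κ r = i).card = c)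
    {b : Bool} (hb : μ 0 b * μ 1 (!b) ≤ μ 0 (!b) * μ 1 b) {rr : ℝ} (hrr : rr = μ 0 b * μ 1 (!b) / (μ 0 (!b) * μ 1 b))
    (hcnt : ∀ a s t, cnt a s t = ((univ.filter fun i : Fin K => a.1 i.succ = s ∧ a.2 i.succ = t).card : ℝ))
    {Dc Nc : (Bool → Bool → ℝ) → ℝ} (hD : ∀ c, Dc c = c b (!b) + c (!b) b) (hN : ∀ c, Nc c = c (!b) (!b))
    {U V W Ψa : ℝ → ℝ → ℝ} {Ψmax ρ : ℝ}
    (eqU : ∀ a : (Fin (K + 1) → Bool) × (Fin (K + 1) → Bool),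
      (t + (1 - t) * w 0) * U (Dc (cnt a)) (Nc (cnt a)) = (1 - t) * w 0 * Ψa (Dc (cnt a)) (Nc (cnt a))
        + t / K * (cnt a b b * U (Dc (cnt a)) (Nc (cnt a)) + cnt a (!b) (!b) * V (Dc (cnt a)) (Nc (cnt a) - 1)
          + Dc (cnt a) * W (Dc (cnt a) - 1) (Nc (cnt a))))
    (eqV : ∀ a : (Fin (K + 1) → Bool) × (Fin (K + 1) → Bool),
      (t + (1 - t) * w 0) * V (Dc (cnt a)) (Nc (cnt a)) = (1 - t) * w 0 * Ψa (Dc (cnt a)) (Nc (cnt a))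
        + t / K * (cnt a b b * (rr * U (Dc (cnt a)) (Nc (cnt a) + 1) + (1 - rr) * V (Dc (cnt a)) (Nc (cnt a)))
          + cnt a (!b) (!b) * V (Dc (cnt a)) (Nc (cnt a))
          + Dc (cnt a) * (rr * W (Dc (cnt a) - 1) (Nc (cnt a) + 1) + (1 - rr) * V (Dc (cnt a)) (Nc (cnt a)))))
    (eqW : ∀ a : (Fin (K + 1) → Bool) × (Fin (K + 1) → Bool),
      (t + (1 - t) * w 0) * W (Dc (cnt a)) (Nc (cnt a)) = (1 - t) * w 0 * Ψa (Dc (cnt a)) (Nc (cnt a))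
        + t / K * (cnt a b b * (rr * U (Dc (cnt a) + 1) (Nc (cnt a)) + (1 - rr) * W (Dc (cnt a)) (Nc (cnt a)))
          + cnt a (!b) (!b) * V (Dc (cnt a) + 1) (Nc (cnt a) - 1)
          + Dc (cnt a) * W (Dc (cnt a)) (Nc (cnt a))))
    (mono : ∀ a : (Fin (K + 1) → Bool) × (Fin (K + 1) → Bool), V (Dc (cnt a) - 1) (Nc (cnt a)) ≤ W (Dc (cnt a)) (Nc (cnt a)))
    (hU0 : ∀ a : (Fin (K + 1) → Bool) × (Fin (K + 1) → Bool), 0 ≤ U (Dc (cnt a)) (Nc (cnt a)))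
    (hV0 : ∀ a : (Fin (K + 1) → Bool) × (Fin (K + 1) → Bool), 0 ≤ V (Dc (cnt a)) (Nc (cnt a)))
    (hW0 : ∀ a : (Fin (K + 1) → Bool) × (Fin (K + 1) → Bool), 0 ≤ W (Dc (cnt a)) (Nc (cnt a)))
    (hΨ0 : ∀ a : (Fin (K + 1) → Bool) × (Fin (K + 1) → Bool), 0 ≤ Ψa (Dc (cnt a)) (Nc (cnt a)))
    (hΨmax : ∀ a : (Fin (K + 1) → Bool) × (Fin (K + 1) → Bool), Ψa (Dc (cnt a)) (Nc (cnt a)) ≤ Ψmax)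
    (hΨ1 : ∀ a : (Fin (K + 1) → Bool) × (Fin (K + 1) → Bool), (∃ i : Fin K, a.1 i.succ ≠ a.2 i.succ) → 1 ≤ Ψa (Dc (cnt a)) (Nc (cnt a)))
    (hρ0 : 0 < ρ) (hρ1 : ρ ≤ 1)
    (contr : ∀ a : (Fin (K + 1) → Bool) × (Fin (K + 1) → Bool),
      μ 0 b * U (Dc (cnt a)) (Nc (cnt a)) + μ 0 (!b) * V (Dc (cnt a)) (Nc (cnt a)) ≤ (1 - ρ) * Ψa (Dc (cnt a)) (Nc (cnt a)))
    {ε : ℝ} (hε : 0 < ε) :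
    mixingTime (fun y z : Fin (K + 1) → Bool =>
        t * ptGraphSwap μ (fun r : Fin m => (((0 : Fin (K + 1)), (κ r).succ) : Fin (K + 1) × Fin (K + 1))) (fun _ : Fin m => Equiv.refl Bool) y z
          + (1 - t) * prodKernel w M y z) (tensorFun μ) ε
      ≤ ⌈1 / ((1 - t) * w 0 * ρ / 4) * Real.log ((Real.exp 1 * Ψmax + 1) / ε)⌉₊ := by
  -- the type-lumped `F` and `Ψ`
  let acc : Bool → Bool → ℝ := fun u v => min 1 (μ 0 v * μ 1 u / (μ 0 u * μ 1 v))
  have hacc : ∀ u v, acc u v = min 1 (μ 0 v * μ 1 u / (μ 0 u * μ 1 v)) := fun u v => rfl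
  let Fl : Bool → Bool → (Bool → Bool → ℝ) → ℝ := fun x0 y0 c =>
    if x0 = y0 then (if x0 = b then U (Dc c) (Nc c) else V (Dc c) (Nc c)) else W (Dc c) (Nc c)
  have hFl : ∀ x0 y0 c, Fl x0 y0 c = if x0 = y0 then (if x0 = b then U (Dc c) (Nc c) else V (Dc c) (Nc c)) else W (Dc c) (Nc c) :=
    fun x0 y0 c => rfl
  let Ψl : Bool → Bool → (Bool → Bool → ℝ) → ℝ := fun _ _ c => Ψa (Dc c) (Nc c)
  have hΨl : ∀ x0 y0 c, Ψl x0 y0 c = Ψa (Dc c) (Nc c) := fun x0 y0 c => rfl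
  have hF0 : ∀ a : (Fin (K + 1) → Bool) × (Fin (K + 1) → Bool), 0 ≤ Fl (a.1 0) (a.2 0) (cnt a) := by
    intro a; rw [hFl]; split_ifs
    · exact hU0 a
    · exact hV0 a
    · exact hW0 a
  refine boolStar_mixingTime_le_of_lumped_supersolution κ hm ht0 ht1 hw0 hw00 hw1 hμ hμ1 hM0 hidle hhom hunif hacc hcnt
    (Fl := Fl) (Ψl := Ψl) (Ψmax := Ψmax) (ρ := ρ) hF0 hΨ0 hΨmax hΨ1 hρ0 hρ1
    (fun a => boolStar_lumped_bracket_of_threeState (w := w) ht0 hμ hb hrr hacc hcnt hD hN hFl hΨl eqU eqV eqW mono a) (fun a => ?_) hε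
  -- the redraw inequality: `Σ_v μ_0(v)·Fl(v,v,cnt) = μ_0(b)·U + μ_0(b̄)·V`
  have e : ∑ v : Bool, μ 0 v * Fl v v (cnt a) = μ 0 b * U (Dc (cnt a)) (Nc (cnt a)) + μ 0 (!b) * V (Dc (cnt a)) (Nc (cnt a)) := by
    rw [Fintype.sum_bool]
    cases b <;> simp [hFl, add_comm]
  rw [e]
  exact contr a

end Law


/-! ## §4 (appended, lean-2 GEN-32) The same with the monotonicity asked only where a defect exists -/

section ReductionWeak
variable {m : ℕ} {w : Fin (K + 1) → ℝ} {t : ℝ} (κ : Fin m → Fin K)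
variable {cnt : (Fin (K + 1) → Bool) × (Fin (K + 1) → Bool) → Bool → Bool → ℝ}

/-- `boolStar_lumped_bracket_of_threeState` with the monotonicity asked only at configurations with a defect (`1 ≤ D`): a crossed level forces `D ≥ 1`. [ours] -/
theorem boolStar_lumped_bracket_of_threeState' (ht0 : 0 ≤ t) (hμ : ∀ k x, 0 < μ k x)
    {b : Bool} (hb : μ 0 b * μ 1 (!b) ≤ μ 0 (!b) * μ 1 b) {rr : ℝ} (hrr : rr = μ 0 b * μ 1 (!b) / (μ 0 (!b) * μ 1 b))
    {acc : Bool → Bool → ℝ} (hacc : ∀ u v, acc u v = min 1 (μ 0 v * μ 1 u / (μ 0 u * μ 1 v)))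
    (hcnt : ∀ a s t, cnt a s t = ((univ.filter fun i : Fin K => a.1 i.succ = s ∧ a.2 i.succ = t).card : ℝ))
    {Dc Nc : (Bool → Bool → ℝ) → ℝ} (hD : ∀ c, Dc c = c b (!b) + c (!b) b) (hN : ∀ c, Nc c = c (!b) (!b))
    {U V W Ψa : ℝ → ℝ → ℝ} {Fl Ψl : Bool → Bool → (Bool → Bool → ℝ) → ℝ}
    (hFl : ∀ x0 y0 c, Fl x0 y0 c = if x0 = y0 then (if x0 = b then U (Dc c) (Nc c) else V (Dc c) (Nc c)) else W (Dc c) (Nc c))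
    (hΨl : ∀ x0 y0 c, Ψl x0 y0 c = Ψa (Dc c) (Nc c))
    (eqU : ∀ a : (Fin (K + 1) → Bool) × (Fin (K + 1) → Bool),
      (t + (1 - t) * w 0) * U (Dc (cnt a)) (Nc (cnt a)) = (1 - t) * w 0 * Ψa (Dc (cnt a)) (Nc (cnt a))
        + t / K * (cnt a b b * U (Dc (cnt a)) (Nc (cnt a)) + cnt a (!b) (!b) * V (Dc (cnt a)) (Nc (cnt a) - 1)
          + Dc (cnt a) * W (Dc (cnt a) - 1) (Nc (cnt a))))
    (eqV : ∀ a : (Fin (K + 1) → Bool) × (Fin (K + 1) → Bool),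
      (t + (1 - t) * w 0) * V (Dc (cnt a)) (Nc (cnt a)) = (1 - t) * w 0 * Ψa (Dc (cnt a)) (Nc (cnt a))
        + t / K * (cnt a b b * (rr * U (Dc (cnt a)) (Nc (cnt a) + 1) + (1 - rr) * V (Dc (cnt a)) (Nc (cnt a)))
          + cnt a (!b) (!b) * V (Dc (cnt a)) (Nc (cnt a))
          + Dc (cnt a) * (rr * W (Dc (cnt a) - 1) (Nc (cnt a) + 1) + (1 - rr) * V (Dc (cnt a)) (Nc (cnt a)))))
    (eqW : ∀ a : (Fin (K + 1) → Bool) × (Fin (K + 1) → Bool),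
      (t + (1 - t) * w 0) * W (Dc (cnt a)) (Nc (cnt a)) = (1 - t) * w 0 * Ψa (Dc (cnt a)) (Nc (cnt a))
        + t / K * (cnt a b b * (rr * U (Dc (cnt a) + 1) (Nc (cnt a)) + (1 - rr) * W (Dc (cnt a)) (Nc (cnt a)))
          + cnt a (!b) (!b) * V (Dc (cnt a) + 1) (Nc (cnt a) - 1)
          + Dc (cnt a) * W (Dc (cnt a)) (Nc (cnt a))))
    (mono : ∀ a : (Fin (K + 1) → Bool) × (Fin (K + 1) → Bool), 1 ≤ Dc (cnt a) → V (Dc (cnt a) - 1) (Nc (cnt a)) ≤ W (Dc (cnt a)) (Nc (cnt a)))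
    (a : (Fin (K + 1) → Bool) × (Fin (K + 1) → Bool)) :
    (1 - t) * w 0 * Ψl (a.1 0) (a.2 0) (cnt a)
        + t / K * ∑ st : Bool × Bool, cnt a st.1 st.2 *
          (min (acc (a.1 0) st.1) (acc (a.2 0) st.2)
              * Fl st.1 st.2 (fun s t' => cnt a s t' - (if st.1 = s ∧ st.2 = t' then 1 else 0) + (if a.1 0 = s ∧ a.2 0 = t' then 1 else 0))
            + (acc (a.1 0) st.1 - min (acc (a.1 0) st.1) (acc (a.2 0) st.2))
              * Fl st.1 (a.2 0) (fun s t' => cnt a s t' - (if st.1 = s ∧ st.2 = t' then 1 else 0) + (if a.1 0 = s ∧ st.2 = t' then 1 else 0))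
            + (acc (a.2 0) st.2 - min (acc (a.1 0) st.1) (acc (a.2 0) st.2))
              * Fl (a.1 0) st.2 (fun s t' => cnt a s t' - (if st.1 = s ∧ st.2 = t' then 1 else 0) + (if st.1 = s ∧ a.2 0 = t' then 1 else 0))
            + (1 - acc (a.1 0) st.1 - acc (a.2 0) st.2 + min (acc (a.1 0) st.1) (acc (a.2 0) st.2)) * Fl (a.1 0) (a.2 0) (cnt a))
      ≤ (t + (1 - t) * w 0) * Fl (a.1 0) (a.2 0) (cnt a) := by
  have hK0 : 0 ≤ t / K := div_nonneg ht0 (Nat.cast_nonneg K)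
  obtain ⟨hnb, hrr0, hrr1⟩ := boolStar_acc_disliked hμ hacc hb hrr
  have hbn := boolStar_acc_liked hμ hacc hb
  have hs := boolStar_acc_self hμ hacc
  have hmin1 : min 1 rr = rr := min_eq_right hrr1
  have hmin2 : min rr 1 = rr := min_eq_left hrr1
  have hc0 : ∀ s t', 0 ≤ cnt a s t' := fun s t' => by rw [hcnt]; exact Nat.cast_nonneg _
  have hDa : Dc (cnt a) = cnt a b (!b) + cnt a (!b) b := hD _
  have e1 := eqU a
  have e2 := eqV a
  have e3 := eqW a
  -- the slack of the crossed levels, both orientations (a crossed level forces `D ≥ 1`)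
  have hc1 : ∀ s t', cnt a s t' ≠ 0 → 1 ≤ cnt a s t' := fun s t' hne => by
    rw [hcnt] at hne ⊢
    exact_mod_cast Nat.one_le_iff_ne_zero.mpr (fun h0 => hne (by rw [h0]; simp))
  have x1 : 0 ≤ t / K * cnt a (!b) b * (1 - rr) * (W (Dc (cnt a)) (Nc (cnt a)) - V (Dc (cnt a) - 1) (Nc (cnt a))) := by
    by_cases h0 : cnt a (!b) b = 0
    · rw [h0]; simp
    · have h1 : 1 ≤ Dc (cnt a) := by rw [hD]; linarith [hc1 _ _ h0, hc0 b (!b)]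
      exact mul_nonneg (mul_nonneg (mul_nonneg hK0 (hc0 _ _)) (by linarith)) (by linarith [mono a h1])
  have x2 : 0 ≤ t / K * cnt a b (!b) * (1 - rr) * (W (Dc (cnt a)) (Nc (cnt a)) - V (Dc (cnt a) - 1) (Nc (cnt a))) := by
    by_cases h0 : cnt a b (!b) = 0
    · rw [h0]; simp
    · have h1 : 1 ≤ Dc (cnt a) := by rw [hD]; linarith [hc1 _ _ h0, hc0 (!b) b]
      exact mul_nonneg (mul_nonneg (mul_nonneg hK0 (hc0 _ _)) (by linarith)) (by linarith [mono a h1])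
  have hDs := boolStar_Dc_shift hD
  have hNs := boolStar_Nc_shift hN
  clear mono eqU eqV eqW hD hN
  obtain ⟨x, y⟩ := a
  cases b <;> simp only [Bool.not_true, Bool.not_false] at hbn hnb e1 e2 e3 x1 x2 hDa hFl hDs hNs <;>
    rcases Bool.eq_false_or_eq_true (x 0) with hx0 | hx0 <;> rcases Bool.eq_false_or_eq_true (y 0) with hy0 | hy0 <;>
    simp only [Fintype.sum_prod_type, Fintype.sum_bool, hx0, hy0, hFl, hΨl, hDs, hNs, hs, hbn, hnb,
      if_true, if_false, true_and, and_true, false_and, and_false, Bool.true_eq_false, Bool.false_eq_true, min_self,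
      hmin1, hmin2, sub_self, sub_zero, add_zero, zero_add, zero_mul, one_mul, sub_add_cancel]
  · linear_combination -e2 - (rr * W (Dc (cnt (x, y)) - 1) (Nc (cnt (x, y)) + 1) + (1 - rr) * V (Dc (cnt (x, y))) (Nc (cnt (x, y)))) * (t / K) * hDa
  · linear_combination -e3 + x2 - W (Dc (cnt (x, y))) (Nc (cnt (x, y))) * (t / K) * hDa
  · linear_combination -e3 + x1 - W (Dc (cnt (x, y))) (Nc (cnt (x, y))) * (t / K) * hDa
  · linear_combination -e1 - W (Dc (cnt (x, y)) - 1) (Nc (cnt (x, y))) * (t / K) * hDa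
  · linear_combination -e1 - W (Dc (cnt (x, y)) - 1) (Nc (cnt (x, y))) * (t / K) * hDa
  · linear_combination -e3 + x1 - W (Dc (cnt (x, y))) (Nc (cnt (x, y))) * (t / K) * hDa
  · linear_combination -e3 + x2 - W (Dc (cnt (x, y))) (Nc (cnt (x, y))) * (t / K) * hDa
  · linear_combination -e2 - (rr * W (Dc (cnt (x, y)) - 1) (Nc (cnt (x, y)) + 1) + (1 - rr) * V (Dc (cnt (x, y))) (Nc (cnt (x, y)))) * (t / K) * hDa

end ReductionWeak

section LawWeak
variable {M : Fin (K + 1) → Bool → Bool → ℝ} {w : Fin (K + 1) → ℝ} {t : ℝ} {m : ℕ} (κ : Fin m → Fin K)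
variable {cnt : (Fin (K + 1) → Bool) × (Fin (K + 1) → Bool) → Bool → Bool → ℝ}

/-- `boolStar_mixingTime_le_of_threeState` with the monotonicity asked only at configurations with `1 ≤ D`. [ours] -/
theorem boolStar_mixingTime_le_of_threeState' (hm : 1 ≤ m) (ht0 : 0 ≤ t) (ht1 : t < 1) (hw0 : ∀ k, 0 ≤ w k) (hw00 : 0 < w 0)
    (hw1 : ∑ k, w k = 1) (hμ : ∀ k x, 0 < μ k x) (hμ1 : ∀ k, ∑ u, μ k u = 1) (hM0 : ∀ u v, M 0 u v = μ 0 v)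
    (hidle : ∀ i : Fin K, ∀ u v, M i.succ u v = if v = u then 1 else 0) (hhom : ∀ i : Fin K, μ i.succ = μ 1)
    {c : ℕ} (hunif : ∀ i : Fin K, (univ.filter fun r : Fin m => κ r = i).card = c)
    {b : Bool} (hb : μ 0 b * μ 1 (!b) ≤ μ 0 (!b) * μ 1 b) {rr : ℝ} (hrr : rr = μ 0 b * μ 1 (!b) / (μ 0 (!b) * μ 1 b))
    (hcnt : ∀ a s t, cnt a s t = ((univ.filter fun i : Fin K => a.1 i.succ = s ∧ a.2 i.succ = t).card : ℝ))
    {Dc Nc : (Bool → Bool → ℝ) → ℝ} (hD : ∀ c, Dc c = c b (!b) + c (!b) b) (hN : ∀ c, Nc c = c (!b) (!b))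
    {U V W Ψa : ℝ → ℝ → ℝ} {Ψmax ρ : ℝ}
    (eqU : ∀ a : (Fin (K + 1) → Bool) × (Fin (K + 1) → Bool),
      (t + (1 - t) * w 0) * U (Dc (cnt a)) (Nc (cnt a)) = (1 - t) * w 0 * Ψa (Dc (cnt a)) (Nc (cnt a))
        + t / K * (cnt a b b * U (Dc (cnt a)) (Nc (cnt a)) + cnt a (!b) (!b) * V (Dc (cnt a)) (Nc (cnt a) - 1)
          + Dc (cnt a) * W (Dc (cnt a) - 1) (Nc (cnt a))))
    (eqV : ∀ a : (Fin (K + 1) → Bool) × (Fin (K + 1) → Bool),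
      (t + (1 - t) * w 0) * V (Dc (cnt a)) (Nc (cnt a)) = (1 - t) * w 0 * Ψa (Dc (cnt a)) (Nc (cnt a))
        + t / K * (cnt a b b * (rr * U (Dc (cnt a)) (Nc (cnt a) + 1) + (1 - rr) * V (Dc (cnt a)) (Nc (cnt a)))
          + cnt a (!b) (!b) * V (Dc (cnt a)) (Nc (cnt a))
          + Dc (cnt a) * (rr * W (Dc (cnt a) - 1) (Nc (cnt a) + 1) + (1 - rr) * V (Dc (cnt a)) (Nc (cnt a)))))
    (eqW : ∀ a : (Fin (K + 1) → Bool) × (Fin (K + 1) → Bool),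
      (t + (1 - t) * w 0) * W (Dc (cnt a)) (Nc (cnt a)) = (1 - t) * w 0 * Ψa (Dc (cnt a)) (Nc (cnt a))
        + t / K * (cnt a b b * (rr * U (Dc (cnt a) + 1) (Nc (cnt a)) + (1 - rr) * W (Dc (cnt a)) (Nc (cnt a)))
          + cnt a (!b) (!b) * V (Dc (cnt a) + 1) (Nc (cnt a) - 1)
          + Dc (cnt a) * W (Dc (cnt a)) (Nc (cnt a))))
    (mono : ∀ a : (Fin (K + 1) → Bool) × (Fin (K + 1) → Bool), 1 ≤ Dc (cnt a) → V (Dc (cnt a) - 1) (Nc (cnt a)) ≤ W (Dc (cnt a)) (Nc (cnt a)))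
    (hU0 : ∀ a : (Fin (K + 1) → Bool) × (Fin (K + 1) → Bool), 0 ≤ U (Dc (cnt a)) (Nc (cnt a)))
    (hV0 : ∀ a : (Fin (K + 1) → Bool) × (Fin (K + 1) → Bool), 0 ≤ V (Dc (cnt a)) (Nc (cnt a)))
    (hW0 : ∀ a : (Fin (K + 1) → Bool) × (Fin (K + 1) → Bool), 0 ≤ W (Dc (cnt a)) (Nc (cnt a)))
    (hΨ0 : ∀ a : (Fin (K + 1) → Bool) × (Fin (K + 1) → Bool), 0 ≤ Ψa (Dc (cnt a)) (Nc (cnt a)))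
    (hΨmax : ∀ a : (Fin (K + 1) → Bool) × (Fin (K + 1) → Bool), Ψa (Dc (cnt a)) (Nc (cnt a)) ≤ Ψmax)
    (hΨ1 : ∀ a : (Fin (K + 1) → Bool) × (Fin (K + 1) → Bool), (∃ i : Fin K, a.1 i.succ ≠ a.2 i.succ) → 1 ≤ Ψa (Dc (cnt a)) (Nc (cnt a)))
    (hρ0 : 0 < ρ) (hρ1 : ρ ≤ 1)
    (contr : ∀ a : (Fin (K + 1) → Bool) × (Fin (K + 1) → Bool),
      μ 0 b * U (Dc (cnt a)) (Nc (cnt a)) + μ 0 (!b) * V (Dc (cnt a)) (Nc (cnt a)) ≤ (1 - ρ) * Ψa (Dc (cnt a)) (Nc (cnt a)))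
    {ε : ℝ} (hε : 0 < ε) :
    mixingTime (fun y z : Fin (K + 1) → Bool =>
        t * ptGraphSwap μ (fun r : Fin m => (((0 : Fin (K + 1)), (κ r).succ) : Fin (K + 1) × Fin (K + 1))) (fun _ : Fin m => Equiv.refl Bool) y z
          + (1 - t) * prodKernel w M y z) (tensorFun μ) ε
      ≤ ⌈1 / ((1 - t) * w 0 * ρ / 4) * Real.log ((Real.exp 1 * Ψmax + 1) / ε)⌉₊ := by
  let acc : Bool → Bool → ℝ := fun u v => min 1 (μ 0 v * μ 1 u / (μ 0 u * μ 1 v))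
  have hacc : ∀ u v, acc u v = min 1 (μ 0 v * μ 1 u / (μ 0 u * μ 1 v)) := fun u v => rfl
  let Fl : Bool → Bool → (Bool → Bool → ℝ) → ℝ := fun x0 y0 c =>
    if x0 = y0 then (if x0 = b then U (Dc c) (Nc c) else V (Dc c) (Nc c)) else W (Dc c) (Nc c)
  have hFl : ∀ x0 y0 c, Fl x0 y0 c = if x0 = y0 then (if x0 = b then U (Dc c) (Nc c) else V (Dc c) (Nc c)) else W (Dc c) (Nc c) :=
    fun x0 y0 c => rfl
  let Ψl : Bool → Bool → (Bool → Bool → ℝ) → ℝ := fun _ _ c => Ψa (Dc c) (Nc c)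
  have hΨl : ∀ x0 y0 c, Ψl x0 y0 c = Ψa (Dc c) (Nc c) := fun x0 y0 c => rfl
  have hF0 : ∀ a : (Fin (K + 1) → Bool) × (Fin (K + 1) → Bool), 0 ≤ Fl (a.1 0) (a.2 0) (cnt a) := by
    intro a; rw [hFl]; split_ifs
    · exact hU0 a
    · exact hV0 a
    · exact hW0 a
  refine boolStar_mixingTime_le_of_lumped_supersolution κ hm ht0 ht1 hw0 hw00 hw1 hμ hμ1 hM0 hidle hhom hunif hacc hcnt
    (Fl := Fl) (Ψl := Ψl) (Ψmax := Ψmax) (ρ := ρ) hF0 hΨ0 hΨmax hΨ1 hρ0 hρ1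
    (fun a => boolStar_lumped_bracket_of_threeState' (w := w) ht0 hμ hb hrr hacc hcnt hD hN hFl hΨl eqU eqV eqW mono a) (fun a => ?_) hε
  have e : ∑ v : Bool, μ 0 v * Fl v v (cnt a) = μ 0 b * U (Dc (cnt a)) (Nc (cnt a)) + μ 0 (!b) * V (Dc (cnt a)) (Nc (cnt a)) := by
    rw [Fintype.sum_bool]
    cases b <;> simp [hFl, add_comm]
  rw [e]
  exact contr a

end LawWeak

end Summit.Ventures.LatticeQCDFlow.Scaling

end
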